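import Mathlib
import Summits.ValiantsHypothesis.ValiantsHypothesis.Theorems.LacunarySymmetroidMatrixDescartesCensusDefs
import Summits.ValiantsHypothesis.ValiantsHypothesis.Theorems.LacunarySymmetroidMatrixDescartesDetLorentzianNonneg

/-!
# Tower graft line — CAUSAL DESCARTES: positive-semidefinite letters are free (a root count charged to LETTER STRUCTURE, all sizes)

Mechanism file for the line `Cruxes/WeakLifting/Lines/tower_graft.lean` (crux `WeakLifting` = stmt-ValiantsHypothesis-19561; letters
spine).  NO stub is claimed.  Planner val-idea-24 g0 REDIRECT 2026-08-28T21:02:04Z («do PSD LETTERS ARE FREE first, at general size m,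
by name»), lead g27 R2800 (C); seat memo `SHADOW-BOUND-23-liftp3g18.md` §3 (evidence on 19561).

THE THEOREM (`card_posRoots_det_le_two_mul_card_touching`).  Let `G = ∑ₗ X^{dₗ} • Sₗ` be a lacunary pencil of real `m × m` matrices
(ANY support `d`, no symmetry asked) in which every letter outside an EXCEPTIONAL set `T ⊆ Fin K` is positive semidefinite.  Then
`Z₊(det G) ≤ 2 · #{α : Fin K → ℕ | Σ α = m, α ≤ m, ∃ l ∈ T, α l ≠ 0}`
— the number of distinct positive zeros of `det G` is at most twice the number of COUNT VECTORS of total degree `m` that TOUCH an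
exceptional letter.  In particular all-PSD pencils have no positive zeros (`card_posRoots_det_eq_zero_of_posSemidef`), and at size
`m = 2` with `k` exceptional letters the bound is `2(kK − C(k,2))` — linear in `K` per indefinite letter against the quadratic Descartes
ceiling `C(K+1,2) − 1` (the memo's Lorentzian count).  It is the first count in this line charged to the STRUCTURE of the letters rather
than to the number of monomials; it has no tower, sector or steepness hypothesis.

ROUTE (all by name).  §1 `signVariations_add_le_two_mul_card_negCoeff`: Mathlib's `Polynomial.signVariations` satisfies
`signVar P + [lc P < 0] ≤ 2·#{k : coeff k < 0}` (induction along `eraseLead`, `signVariations_eq_eraseLead_add_ite`), so with Mathlib's rule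
of signs `roots_countP_pos_le_signVariations`: `Z₊(P) ≤ 2·#negative coefficients` (`card_posRoots_le_two_mul_card_negCoeff`).  §2 the lacunary
pencil determinant is the specialisation `X_l ↦ X^{dₗ}` of the generic determinant `det ∑ X_l • S_l ∈ ℝ[X_0..X_{K−1}]` (`det_pencil_eq_aeval`,
`AlgHom.map_det`), whose `X^e`-coefficient is the sum of the generic coefficients over the exponent vectors of `d`-weight `e`
(`coeff_det_pencil_eq_sum_weight`).  §3 a generic coefficient whose exponent vector does NOT touch `T` is unchanged when the letters of `T`
are zeroed (`coeff_genPencil_eq_zeroOut`, the substitution `X_l ↦ 0` on `T`), and the zeroed tuple is all-PSD, so that coefficient is `≥ 0` by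
the tree's Cauchy–Binet lemma `DetLorentzian.coeff_det_pencil_nonneg` (Borcea–Brändén 2009 Prop. 2.4, `…DetLorentzianNonneg.lean`, val-lit
lane); hence a NEGATIVE coefficient of `det G` is the `d`-weight of a touching exponent vector, which lies on the layer `Σ α = m` by the tree's
homogeneity lemma `DetLorentzian.detArray_eq_zero_of_not_mem_layer` (`exists_touching_of_coeff_neg`).  §4 counts.

Def-free; Mathlib + `…CensusDefs` + `…DetLorentzianNonneg`.  HONEST FRAMING: an exact Descartes-type law; where every letter is indefinite
it says nothing new (`T = univ` gives back a count of all of `Δ(m,K)`); nothing on S4b/S4f/S5, TowerB, `WeakLifting`, Conjecture B, 18050 or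
`VP ≠ VNP`.  Seat: prover val-sym-lift-p3 g18, `--supports stmt-ValiantsHypothesis-19561`.
-/

-- `Summit.ValiantsHypothesis.ValiantsHypothesis.…` repeats a component by the D-0017 layout
-- (single-conjunct summit), which the `dupNamespace` linter flags; the name is mandated.
set_option linter.dupNamespace false

namespace Summit.ValiantsHypothesis.ValiantsHypothesis.Theorems.KPlusLogSqLaw.TowerGraft

open Finset Polynomial Matrix
open scoped BigOperators Polynomial

/-! ## §1 Sign variations are at most twice the number of negative coefficients -/

/-- number of negative coefficients: `eraseLead` bookkeeping. [folklore] -/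
theorem card_negCoeff_eq_eraseLead (P : ℝ[X]) (hP : P ≠ 0) :
    (P.support.filter fun k => P.coeff k < 0).card =
      (P.eraseLead.support.filter fun k => P.eraseLead.coeff k < 0).card + (if P.leadingCoeff < 0 then 1 else 0) := by
  classical
  have hsupp : P.support = insert P.natDegree P.eraseLead.support := by
    rw [Polynomial.eraseLead_support, Finset.insert_erase (Polynomial.natDegree_mem_support_of_nonzero hP)]
  rw [hsupp, Finset.filter_insert]
  have hrest : (P.eraseLead.support.filter fun k => P.coeff k < 0) =
      (P.eraseLead.support.filter fun k => P.eraseLead.coeff k < 0) := by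
    refine Finset.filter_congr fun k hk => ?_
    have hk' : k ≠ P.natDegree := fun h => Polynomial.natDegree_notMem_eraseLead_support (h ▸ hk)
    rw [Polynomial.eraseLead_coeff_of_ne k hk']
  by_cases hlc : P.leadingCoeff < 0
  · have hlc' : P.coeff P.natDegree < 0 := hlc
    rw [if_pos hlc', if_pos hlc, Finset.card_insert_of_notMem, hrest]
    exact fun h => Polynomial.natDegree_notMem_eraseLead_support (Finset.mem_filter.mp h).1
  · have hlc' : ¬ P.coeff P.natDegree < 0 := hlc
    rw [if_neg hlc', if_neg hlc, hrest, add_zero]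

/-- **sign variations ≤ 2 · #(negative coefficients) − [leading coefficient negative]** (each negative coefficient opens and
closes at most one excursion of the sign sequence). [folklore] -/
theorem signVariations_add_le_two_mul_card_negCoeff (P : ℝ[X]) :
    P.signVariations + (if P.leadingCoeff < 0 then 1 else 0) ≤ 2 * (P.support.filter fun k => P.coeff k < 0).card := by
  classical
  induction h : P.support.card using Nat.strong_induction_on generalizing P with
  | _ n ih =>
    by_cases hP : P = 0
    · subst hP; simp
    have hlt : P.eraseLead.support.card < n := h ▸ Polynomial.eraseLead_support_card_lt hP
    have hQ := ih _ hlt P.eraseLead rfl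
    rw [Polynomial.signVariations_eq_eraseLead_add_ite hP, card_negCoeff_eq_eraseLead P hP]
    have hlc : P.leadingCoeff ≠ 0 := Polynomial.leadingCoeff_ne_zero.mpr hP
    by_cases hQ0 : P.eraseLead = 0
    · -- `P` is a monomial
      rw [hQ0] at hQ ⊢
      simp only [Polynomial.signVariations_zero, Polynomial.leadingCoeff_zero, sign_zero, neg_zero, Polynomial.support_zero,
        Finset.filter_empty, Finset.card_empty, zero_add]
      rw [if_neg (by simpa using hlc)]
      split_ifs <;> omega
    have hlcQ : P.eraseLead.leadingCoeff ≠ 0 := Polynomial.leadingCoeff_ne_zero.mpr hQ0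
    rcases lt_or_gt_of_ne hlc with hneg | hpos
    · -- leading coefficient negative
      rw [if_pos hneg, sign_neg hneg]
      rcases lt_or_gt_of_ne hlcQ with hQneg | hQpos
      · rw [sign_neg hQneg, if_pos hQneg] at *
        rw [if_neg (by decide)]
        omega
      · rw [sign_pos hQpos, if_neg (not_lt.mpr hQpos.le)] at *
        rw [if_pos (by decide)]
        omega
    · rw [if_neg (not_lt.mpr hpos.le), sign_pos hpos]
      rcases lt_or_gt_of_ne hlcQ with hQneg | hQpos
      · rw [sign_neg hQneg, if_pos hQneg] at *
        rw [if_pos (by decide)]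
        omega
      · rw [sign_pos hQpos, if_neg (not_lt.mpr hQpos.le)] at *
        rw [if_neg (by decide)]
        omega

/-- hence `signVariations P ≤ 2 · #{k : coeff k < 0}`. [folklore] -/
theorem signVariations_le_two_mul_card_negCoeff (P : ℝ[X]) :
    P.signVariations ≤ 2 * (P.support.filter fun k => P.coeff k < 0).card :=
  le_trans (Nat.le_add_right _ _) (signVariations_add_le_two_mul_card_negCoeff P)

/-- **Descartes with a negative-coefficient budget**: the number of DISTINCT positive roots of a real polynomial is at most twice
the number of its negative coefficients (Mathlib's rule of signs `roots_countP_pos_le_signVariations`). [folklore] -/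
theorem card_posRoots_le_two_mul_card_negCoeff (P : ℝ[X]) :
    (P.roots.toFinset.filter (fun t => 0 < t)).card ≤ 2 * (P.support.filter fun k => P.coeff k < 0).card := by
  classical
  calc (P.roots.toFinset.filter (fun t => 0 < t)).card = ((P.roots.filter (fun t => 0 < t)).toFinset).card := by
        rw [Multiset.toFinset_filter]
    _ ≤ (P.roots.filter (fun t => 0 < t)).card := Multiset.toFinset_card_le _
    _ = P.roots.countP (fun t => 0 < t) := (Multiset.countP_eq_card_filter _ _).symm
    _ ≤ P.signVariations := P.roots_countP_pos_le_signVariations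
    _ ≤ _ := signVariations_le_two_mul_card_negCoeff P

/-! ## §2 The lacunary pencil is the specialisation `X_l ↦ X^{d_l}` of the generic multivariate pencil -/

section Specialise

variable {m K : ℕ}

/-- specialising a monomial: `X^α ↦ C c · X^{∑ α_l d_l}`. [folklore] -/
theorem aeval_pow_monomial (d : Fin K → ℕ) (α : Fin K →₀ ℕ) (c : ℝ) :
    MvPolynomial.aeval (fun l => (X : ℝ[X]) ^ d l) (MvPolynomial.monomial α c) =
      Polynomial.C c * (X : ℝ[X]) ^ (∑ l, α l * d l) := by
  rw [MvPolynomial.aeval_monomial, ← Polynomial.C_eq_algebraMap, Finsupp.prod_fintype _ _ (fun i => by simp)]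
  simp_rw [← pow_mul, Finset.prod_pow_eq_pow_sum, mul_comm (d _)]

/-- **coefficient formula for the specialisation**: the coefficient of `X^e` in `P(X^{d_0}, …, X^{d_{K−1}})` is the sum of the
coefficients of `P` over the exponent vectors of `d`-weight `e`. [folklore] -/
theorem coeff_aeval_pow (d : Fin K → ℕ) (P : MvPolynomial (Fin K) ℝ) (e : ℕ) :
    (MvPolynomial.aeval (fun l => (X : ℝ[X]) ^ d l) P).coeff e =
      ∑ α ∈ P.support with (∑ l, α l * d l) = e, P.coeff α := by
  classical
  conv_lhs => rw [P.as_sum]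
  rw [map_sum, Polynomial.finsetSum_coeff, Finset.sum_filter]
  refine Finset.sum_congr rfl fun α _ => ?_
  rw [aeval_pow_monomial, Polynomial.coeff_C_mul, Polynomial.coeff_X_pow]
  rcases eq_or_ne (∑ l, α l * d l) e with h | h
  · simp [h]
  · simp [h, Ne.symm h]

/-- **the lacunary pencil determinant is the specialisation of the generic one**: `det ∑ X^{dₗ}•Sₗ = (det ∑ X_l•S_l)(X^{d})`.
[folklore] -/
theorem det_pencil_eq_aeval (d : Fin K → ℕ) (S : Fin K → Matrix (Fin m) (Fin m) ℝ) :
    (∑ l, ((X : ℝ[X]) ^ d l) • (S l).map Polynomial.C).det =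
      MvPolynomial.aeval (fun l => (X : ℝ[X]) ^ d l) (∑ l, (MvPolynomial.X l : MvPolynomial (Fin K) ℝ) • (S l).map (MvPolynomial.C : ℝ →+* MvPolynomial (Fin K) ℝ)).det := by
  rw [AlgHom.map_det]
  congr 1
  refine Matrix.ext fun i j => ?_
  simp only [AlgHom.mapMatrix_apply, Matrix.map_apply, Matrix.sum_apply, Matrix.smul_apply, smul_eq_mul, map_sum, map_mul,
    MvPolynomial.aeval_X, MvPolynomial.aeval_C, Polynomial.algebraMap_eq]

/-- hence the coefficient of `X^e` in the lacunary pencil determinant is the sum of the generic coefficients of `d`-weight `e`. -/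
theorem coeff_det_pencil_eq_sum_weight (d : Fin K → ℕ) (S : Fin K → Matrix (Fin m) (Fin m) ℝ) (e : ℕ) :
    (∑ l, ((X : ℝ[X]) ^ d l) • (S l).map Polynomial.C).det.coeff e =
      ∑ α ∈ (∑ l, (MvPolynomial.X l : MvPolynomial (Fin K) ℝ) • (S l).map (MvPolynomial.C : ℝ →+* MvPolynomial (Fin K) ℝ)).det.support with (∑ l, α l * d l) = e, (∑ l, (MvPolynomial.X l : MvPolynomial (Fin K) ℝ) • (S l).map (MvPolynomial.C : ℝ →+* MvPolynomial (Fin K) ℝ)).det.coeff α := by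
  rw [det_pencil_eq_aeval, coeff_aeval_pow]

/-! ## §3 Coefficients not touching an exceptional letter are nonnegative -/

/-- zeroing the letters in `T`: `X_l ↦ 0` (`l ∈ T`), `X_l ↦ X_l` otherwise, maps the generic pencil of `S` to the generic pencil of the
zeroed tuple. [folklore] -/
theorem aeval_zeroOut_genPencil (S : Fin K → Matrix (Fin m) (Fin m) ℝ) (T : Finset (Fin K)) :
    MvPolynomial.aeval (fun l => if l ∈ T then (0 : MvPolynomial (Fin K) ℝ) else MvPolynomial.X l) (∑ l, (MvPolynomial.X l : MvPolynomial (Fin K) ℝ) • (S l).map (MvPolynomial.C : ℝ →+* MvPolynomial (Fin K) ℝ)).det =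
      (∑ l, (MvPolynomial.X l : MvPolynomial (Fin K) ℝ) • ((fun l => if l ∈ T then (0 : Matrix (Fin m) (Fin m) ℝ) else S l) l).map (MvPolynomial.C : ℝ →+* MvPolynomial (Fin K) ℝ)).det := by
  rw [AlgHom.map_det]
  congr 1
  refine Matrix.ext fun i j => ?_
  simp only [AlgHom.mapMatrix_apply, Matrix.map_apply, Matrix.sum_apply, Matrix.smul_apply, smul_eq_mul, map_sum, map_mul,
    MvPolynomial.aeval_X, MvPolynomial.aeval_C, MvPolynomial.algebraMap_eq]
  refine Finset.sum_congr rfl fun l _ => ?_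
  split_ifs <;> simp

/-- zeroing kills exactly the monomials touching `T`. [folklore] -/
theorem aeval_zeroOut_monomial (T : Finset (Fin K)) (β : Fin K →₀ ℕ) (c : ℝ) :
    MvPolynomial.aeval (fun l => if l ∈ T then (0 : MvPolynomial (Fin K) ℝ) else MvPolynomial.X l) (MvPolynomial.monomial β c) =
      if ∃ l ∈ T, β l ≠ 0 then 0 else MvPolynomial.monomial β c := by
  classical
  rw [MvPolynomial.aeval_monomial, MvPolynomial.algebraMap_eq, Finsupp.prod_fintype _ _ (fun i => by simp)]
  split_ifs with h
  · obtain ⟨l, hlT, hl⟩ := h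
    have : (if l ∈ T then (0 : MvPolynomial (Fin K) ℝ) else MvPolynomial.X l) ^ β l = 0 := by
      rw [if_pos hlT, zero_pow hl]
    rw [Finset.prod_eq_zero (Finset.mem_univ l) this, mul_zero]
  · push Not at h
    rw [MvPolynomial.monomial_eq, Finsupp.prod_fintype _ _ (fun i => by simp)]
    congr 1
    refine Finset.prod_congr rfl fun l _ => ?_
    by_cases hl : l ∈ T
    · rw [h l hl, pow_zero, pow_zero]
    · rw [if_neg hl]

/-- for an exponent vector NOT touching `T`, the generic coefficient is unchanged by zeroing the letters of `T`. [folklore] -/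
theorem coeff_genPencil_eq_zeroOut (S : Fin K → Matrix (Fin m) (Fin m) ℝ) (T : Finset (Fin K)) (α : Fin K →₀ ℕ)
    (hα : ∀ l ∈ T, α l = 0) :
    (∑ l, (MvPolynomial.X l : MvPolynomial (Fin K) ℝ) • (S l).map (MvPolynomial.C : ℝ →+* MvPolynomial (Fin K) ℝ)).det.coeff α = (∑ l, (MvPolynomial.X l : MvPolynomial (Fin K) ℝ) • ((fun l => if l ∈ T then (0 : Matrix (Fin m) (Fin m) ℝ) else S l) l).map (MvPolynomial.C : ℝ →+* MvPolynomial (Fin K) ℝ)).det.coeff α := by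
  classical
  rw [← aeval_zeroOut_genPencil]
  set P := (∑ l, (MvPolynomial.X l : MvPolynomial (Fin K) ℝ) • (S l).map (MvPolynomial.C : ℝ →+* MvPolynomial (Fin K) ℝ)).det
  conv_rhs => rw [P.as_sum]
  rw [map_sum, MvPolynomial.coeff_sum]
  simp_rw [aeval_zeroOut_monomial]
  rw [Finset.sum_eq_single α]
  · rw [if_neg (by push Not; exact hα), MvPolynomial.coeff_monomial, if_pos rfl]
  · intro β _ hβ
    split_ifs
    · exact MvPolynomial.coeff_zero _
    · rw [MvPolynomial.coeff_monomial, if_neg hβ]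
  · intro hα'
    rw [MvPolynomial.notMem_support_iff.mp hα']
    split_ifs
    · exact MvPolynomial.coeff_zero _
    · rw [MvPolynomial.coeff_monomial, if_pos rfl]

/-- **non-touching generic coefficients are nonnegative** when every letter outside `T` is positive semidefinite (tree
`DetLorentzian.coeff_det_pencil_nonneg` applied to the zeroed tuple, whose letters are all PSD). [this work] -/
theorem coeff_genPencil_nonneg_of_not_touching (S : Fin K → Matrix (Fin m) (Fin m) ℝ) (T : Finset (Fin K))
    (hS : ∀ l ∉ T, (S l).PosSemidef) (α : Fin K →₀ ℕ) (hα : ∀ l ∈ T, α l = 0) :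
    0 ≤ (∑ l, (MvPolynomial.X l : MvPolynomial (Fin K) ℝ) • (S l).map (MvPolynomial.C : ℝ →+* MvPolynomial (Fin K) ℝ)).det.coeff α := by
  rw [coeff_genPencil_eq_zeroOut S T α hα]
  refine Summit.ValiantsHypothesis.ValiantsHypothesis.Theorems.LacunarySymmetroidMatrixDescartes.DetLorentzian.coeff_det_pencil_nonneg
    _ (fun l => ?_) α
  by_cases hl : l ∈ T
  · simp only [hl, if_true]; exact Matrix.PosSemidef.zero
  · simp only [hl, if_false]; exact hS l hl

/-- **a negative coefficient of the lacunary pencil determinant is the weight of a TOUCHING exponent vector of total degree `m`.**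
[this work] -/
theorem exists_touching_of_coeff_neg (d : Fin K → ℕ) (S : Fin K → Matrix (Fin m) (Fin m) ℝ) (T : Finset (Fin K))
    (hS : ∀ l ∉ T, (S l).PosSemidef) {e : ℕ}
    (he : (∑ l, ((X : ℝ[X]) ^ d l) • (S l).map Polynomial.C).det.coeff e < 0) :
    ∃ α : Fin K → ℕ, α ∈ (Fintype.piFinset fun _ : Fin K => Finset.range (m + 1)).filter
        (fun α => ∑ i, α i = m ∧ ∃ l ∈ T, α l ≠ 0) ∧ ∑ l, α l * d l = e := by
  classical
  rw [coeff_det_pencil_eq_sum_weight] at he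
  obtain ⟨β, hβ, hneg⟩ := Finset.exists_lt_of_sum_lt (lt_of_lt_of_eq he Finset.sum_const_zero.symm)
  rw [Finset.mem_filter] at hβ
  obtain ⟨hβsupp, hβe⟩ := hβ
  have htouch : ∃ l ∈ T, β l ≠ 0 := by
    by_contra h
    push Not at h
    exact (coeff_genPencil_nonneg_of_not_touching S T hS β h).not_gt hneg
  -- `β` lies on the layer `Σ β = m` (homogeneity), hence in the box
  have hlayer : (⇑β : Fin K → ℕ) ∈ (Fintype.piFinset fun _ : Fin K => Finset.range (m + 1)).filter (fun α => ∑ i, α i = m) := by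
    by_contra hlayer
    have h0 := Summit.ValiantsHypothesis.ValiantsHypothesis.Theorems.LacunarySymmetroidMatrixDescartes.DetLorentzian.detArray_eq_zero_of_not_mem_layer
      m K S β hlayer
    simp only [Finsupp.equivFunOnFinite_symm_coe] at h0
    exact (MvPolynomial.mem_support_iff.mp hβsupp) h0
  rw [Finset.mem_filter] at hlayer
  exact ⟨β, Finset.mem_filter.mpr ⟨hlayer.1, hlayer.2, htouch⟩, hβe⟩

/-! ## §4 The count: positive-semidefinite letters are free -/

/-- **CAUSAL DESCARTES — PSD LETTERS ARE FREE (all sizes).**  Let `G = ∑ₗ X^{dₗ} • Sₗ` be a lacunary pencil of real `m × m` matrices in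
which every letter outside the EXCEPTIONAL set `T` is positive semidefinite (the letters in `T` are arbitrary).  Then the number of distinct
positive zeros of `det G` is at most twice the number of count vectors `α` (`|α| = m`) that TOUCH an exceptional letter:
`Z₊(det G) ≤ 2 · #{α ∈ Δ(m,K) : ∃ l ∈ T, α_l ≠ 0}` — every coefficient whose exponent is not the `d`-weight of a touching count vector
is `≥ 0` (Cauchy–Binet, tree `DetLorentzian.coeff_det_pencil_nonneg`), and Descartes' rule of signs charges two sign variations per
negative coefficient.  No symmetry, tower, sector or steepness hypothesis.  `T = ∅`: no positive zeros at all. [this work] -/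
theorem card_posRoots_det_le_two_mul_card_touching (d : Fin K → ℕ) (S : Fin K → Matrix (Fin m) (Fin m) ℝ) (T : Finset (Fin K))
    (hS : ∀ l ∉ T, (S l).PosSemidef) :
    ((∑ l, ((X : ℝ[X]) ^ d l) • (S l).map Polynomial.C).det.roots.toFinset.filter (fun t => 0 < t)).card ≤
      2 * ((Fintype.piFinset fun _ : Fin K => Finset.range (m + 1)).filter
        (fun α => ∑ i, α i = m ∧ ∃ l ∈ T, α l ≠ 0)).card := by
  classical
  set F := (∑ l, ((X : ℝ[X]) ^ d l) • (S l).map Polynomial.C).det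
  refine (card_posRoots_le_two_mul_card_negCoeff F).trans (Nat.mul_le_mul_left 2 ?_)
  -- the negative coefficients inject into the touching count vectors via the weight map
  set Touch := (Fintype.piFinset fun _ : Fin K => Finset.range (m + 1)).filter (fun α => ∑ i, α i = m ∧ ∃ l ∈ T, α l ≠ 0)
  calc (F.support.filter fun k => F.coeff k < 0).card
      ≤ (Touch.image fun α => ∑ l, α l * d l).card := by
        refine Finset.card_le_card fun e he => ?_
        rw [Finset.mem_filter] at he
        obtain ⟨α, hα, hαe⟩ := exists_touching_of_coeff_neg d S T hS he.2
        exact Finset.mem_image.mpr ⟨α, hα, hαe⟩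
    _ ≤ Touch.card := Finset.card_image_le

/-- the case `T = ∅`: a pencil with ALL letters positive semidefinite has no positive zeros of its determinant (unless it is the zero
polynomial, which has none counted either). [folklore] -/
theorem card_posRoots_det_eq_zero_of_posSemidef (d : Fin K → ℕ) (S : Fin K → Matrix (Fin m) (Fin m) ℝ)
    (hS : ∀ l, (S l).PosSemidef) :
    ((∑ l, ((X : ℝ[X]) ^ d l) • (S l).map Polynomial.C).det.roots.toFinset.filter (fun t => 0 < t)).card = 0 := by
  have h := card_posRoots_det_le_two_mul_card_touching d S ∅ (fun l _ => hS l)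
  simpa using h

end Specialise

end Summit.ValiantsHypothesis.ValiantsHypothesis.Theorems.KPlusLogSqLaw.TowerGraft
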